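import Summits.RiemannHypothesis.RiemannHypothesis.Theorems.OddSectorOddBartaFloorToothSum
import HarnessLib

/-!
# Crux `OddSector.OddBartaFloor`, line `Sketch`: the prime-layer floor (the lead's stub)

Stub `stub_primeLayerFloor` of the skeleton of crux item stmt-RiemannHypothesis-17779 (route
`RiemannHypothesis/OddSector`): on `(0, a)` the prime layer
`P_a(t) = Σ_n Λ(n) n^{-1/2} (R_a(t − log n) + R_a(t + log n))` of the window image of the odd theta
probe is bounded below by `e(a)·Φ′(t) = −e(a)|Φ′(t)|` with `e(a) → 0`, for all `a ≥ 1`.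

Termwise, with `c_n = Λ(n)n^{-1/2}`: `R_a(t + log n) = |Φ′(log n + t)|𝟙_{log n + t > a} ≥ 0` and
`R_a(t − log n) = −|Φ′(log n − t)|𝟙_{log n > a + t}` (the WRONG-SIGN LAYER). Two regimes:
* ORIGIN `t ≤ 1/2`: pair each wrong-sign atom with its twin,
  `|Φ′(log n + t)| − |Φ′(log n − t)| ≥ −2t·sup|Φ″| ≥ −C e t n^{−2}` (mean value theorem, decay
  `|Φ_RT″(u)| ≤ Ce^{−4u}`), while `|Φ′(t)| ≥ c t`; the atoms live at `n > e^a`, so the loss is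
  `(2Ce/c)·Σ_{n>e^a} n^{−2} · |Φ′(t)|`;
* BULK/EDGE `t ≥ 1/2`: the ratio bound `|Φ′(s₂)| ≤ 2e^{−K(s₁)(s₂−s₁)}|Φ′(s₁)|`,
  `K(s) = 2πe^{2s} − 13/2`, used twice (`t → a → log n − t`) gives
  `|Φ′(log n − t)| ≤ 4e^{−K(a)(log n − a − t)}|Φ′(t)|`, `c_n ≤ 4e^{−a/4}`, and
  `Σ_{n > e^{a+t}} e^{−K(a)(log n − a − t)} ≤ 3` (`stub_toothSum`, `K(a) ≥ 5e^{a+t}`).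
Only `Λ(n) ≤ log n` is used about the primes.
-/

set_option linter.dupNamespace false

noncomputable section

open Set MeasureTheory Filter
open scoped Real Topology ArithmeticFunction.vonMangoldt

namespace Summit.RiemannHypothesis.RiemannHypothesis.Theorems.OddBartaFloor

open Literature.NumberTheory.LFunctions

/-! ## Termwise analysis of the prime layer -/

/-- For `log n ≤ a + t` (`0 < t < a`) the `n`-th term of the prime layer is `≥ 0`
(the wrong-sign atom is absent, the right-tail atom is `|Φ′| ≥ 0`). -/
theorem primeLayer_term_nonneg {a t : ℝ} (ht : 0 < t) (hta : t < a) {n : ℕ}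
    (hn : Real.log n ≤ a + t) :
    0 ≤ (Λ n : ℝ) / Real.sqrt n *
      (oddThetaTail a (t - Real.log n) + oddThetaTail a (t + Real.log n)) := by
  have hlog0 : 0 ≤ Real.log n := Real.log_natCast_nonneg n
  have h1 : oddThetaTail a (t - Real.log n) = 0 := oddThetaTail_of_mem ⟨by linarith, by linarith⟩
  have h2 : 0 ≤ oddThetaTail a (t + Real.log n) := by
    by_cases hm : t + Real.log n ∈ Icc (-a) a
    · rw [oddThetaTail_of_mem hm]
    · rw [oddThetaTail_of_not_mem hm]
      have : 0 < t + Real.log n := by linarith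
      linarith [weilThetaPhiDeriv_neg_of_pos this]
  rw [h1, zero_add]
  exact mul_nonneg (vonMangoldt_div_sqrt_nonneg n) h2

/-- For `log n > a + t` the `n`-th term is `c_n (Φ′(log n − t) − Φ′(log n + t))`. -/
theorem primeLayer_term_eq {a t : ℝ} (ht : 0 < t) {n : ℕ} (hn : a + t < Real.log n) :
    (Λ n : ℝ) / Real.sqrt n * (oddThetaTail a (t - Real.log n) + oddThetaTail a (t + Real.log n)) =
      (Λ n : ℝ) / Real.sqrt n *
        (weilThetaPhiDeriv (Real.log n - t) - weilThetaPhiDeriv (Real.log n + t)) := by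
  have h1 : oddThetaTail a (t - Real.log n) = weilThetaPhiDeriv (Real.log n - t) := by
    rw [oddThetaTail_of_not_mem (fun h => by linarith [h.1]),
      show t - Real.log n = -(Real.log n - t) by ring, weilThetaPhiDeriv_neg]
    ring
  have h2 : oddThetaTail a (t + Real.log n) = -weilThetaPhiDeriv (Real.log n + t) := by
    rw [oddThetaTail_of_not_mem (fun h => by linarith [h.2]), add_comm]
  rw [h1, h2]
  ring

/-- A natural number with `log n > 0` is positive (as a real). -/
theorem natCast_pos_of_log_pos {n : ℕ} (h : 0 < Real.log n) : (0 : ℝ) < n := by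
  rcases Nat.eq_zero_or_pos n with rfl | hn
  · simp at h
  · exact_mod_cast hn

/-- **Origin regime, termwise.** For `a ≥ 1`, `0 < t ≤ 1/2` and `log n > a + t`: pairing the
wrong-sign atom `|Φ′(log n − t)|` with its twin `|Φ′(log n + t)|` by the mean value theorem and the
decay `|Φ_RT″(u)| ≤ Ce^{−4u}` gives `term_n ≥ −2Cet/n²`. -/
theorem primeLayer_term_origin {C a t : ℝ}
    (hC : ∀ u : ℝ, 0 ≤ u → |deBruijnPhiDeriv₂ u| ≤ C * rexp (-4 * u))
    (ha : 1 ≤ a) (ht : 0 < t) (ht2 : t ≤ 1 / 2) {n : ℕ} (hn : a + t < Real.log n) :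
    -(2 * C * rexp 1 * t / (n : ℝ) ^ 2) ≤
      (Λ n : ℝ) / Real.sqrt n *
        (oddThetaTail a (t - Real.log n) + oddThetaTail a (t + Real.log n)) := by
  rw [primeLayer_term_eq ht hn]
  have hnpos : (0 : ℝ) < n := natCast_pos_of_log_pos (by linarith)
  have hC0 : 0 ≤ C := by
    have h := hC 0 le_rfl
    simp only [mul_zero, Real.exp_zero, mul_one] at h
    exact (abs_nonneg _).trans h
  set x : ℝ := Real.log n - t with hx
  set y : ℝ := Real.log n + t with hy
  have hxy : x ≤ y := by simp only [hx, hy]; linarith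
  have hx0 : 0 < x := by simp only [hx]; linarith
  set B : ℝ := C * (rexp 1 / (n : ℝ) ^ 2) * (1 / 2) with hB
  -- the derivative bound on `[x, y]`
  have hbound : ∀ ξ ∈ Icc x y, ‖deBruijnPhiDeriv₂ (ξ / 2) * (1 / 2)‖ ≤ B := fun ξ hξ => by
    have hξ0 : 0 ≤ ξ / 2 := by linarith [hξ.1]
    have h1 := hC (ξ / 2) hξ0
    rw [Real.norm_eq_abs, abs_mul, abs_of_pos (by norm_num : (0 : ℝ) < 1 / 2)]
    have h2 : rexp (-4 * (ξ / 2)) ≤ rexp 1 / (n : ℝ) ^ 2 := by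
      have h3 : rexp (-4 * (ξ / 2)) ≤ rexp (-2 * x) := Real.exp_le_exp.2 (by linarith [hξ.1])
      refine h3.trans ?_
      have e1 : rexp (-2 * x) = rexp (2 * t) / (n : ℝ) ^ 2 := by
        have e2 : -2 * x = 2 * t - ((2 : ℕ) : ℝ) * Real.log n := by simp only [hx]; push_cast; ring
        rw [e2, Real.exp_sub, Real.exp_nat_mul, Real.exp_log hnpos]
      rw [e1]
      exact div_le_div_of_nonneg_right (Real.exp_le_exp.2 (by linarith)) (by positivity)
    calc |deBruijnPhiDeriv₂ (ξ / 2)| * (1 / 2) ≤ C * rexp (-4 * (ξ / 2)) * (1 / 2) :=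
          mul_le_mul_of_nonneg_right h1 (by norm_num)
      _ ≤ C * (rexp 1 / (n : ℝ) ^ 2) * (1 / 2) :=
          mul_le_mul_of_nonneg_right (mul_le_mul_of_nonneg_left h2 hC0) (by norm_num)
  have hMVT : ‖weilThetaPhiDeriv y - weilThetaPhiDeriv x‖ ≤ B * ‖y - x‖ :=
    Convex.norm_image_sub_le_of_norm_hasDerivWithin_le
      (fun ξ _ => (hasDerivAt_weilThetaPhiDeriv ξ).hasDerivWithinAt) hbound (convex_Icc x y)
      (left_mem_Icc.2 hxy) (right_mem_Icc.2 hxy)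
  have hyx : ‖y - x‖ = 2 * t := by
    rw [Real.norm_eq_abs, abs_of_nonneg (by linarith)]; simp only [hx, hy]; ring
  rw [hyx, Real.norm_eq_abs] at hMVT
  -- `|Φ′(y) − Φ′(x)| ≤ C e t / n²`
  have hdiff : |weilThetaPhiDeriv y - weilThetaPhiDeriv x| ≤ C * rexp 1 * t / (n : ℝ) ^ 2 := by
    refine hMVT.trans (le_of_eq ?_)
    simp only [hB]; field_simp
  have hc := vonMangoldt_div_sqrt_le_two n
  have hc0 := vonMangoldt_div_sqrt_nonneg n
  have hpos : 0 ≤ C * rexp 1 * t / (n : ℝ) ^ 2 := by positivity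
  have h1 : -(C * rexp 1 * t / (n : ℝ) ^ 2) ≤ weilThetaPhiDeriv x - weilThetaPhiDeriv y := by
    have := le_abs_self (weilThetaPhiDeriv y - weilThetaPhiDeriv x)
    linarith
  have h2 : 0 ≤ (Λ n : ℝ) / Real.sqrt n *
      (weilThetaPhiDeriv x - weilThetaPhiDeriv y + C * rexp 1 * t / (n : ℝ) ^ 2) :=
    mul_nonneg hc0 (by linarith)
  have h3 : 0 ≤ (C * rexp 1 * t / (n : ℝ) ^ 2) * (2 - (Λ n : ℝ) / Real.sqrt n) :=
    mul_nonneg hpos (by linarith)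
  have e1 := mul_add ((Λ n : ℝ) / Real.sqrt n) (weilThetaPhiDeriv x - weilThetaPhiDeriv y)
    (C * rexp 1 * t / (n : ℝ) ^ 2)
  have e2 : (C * rexp 1 * t / (n : ℝ) ^ 2) * (2 - (Λ n : ℝ) / Real.sqrt n) =
      2 * (C * rexp 1 * t / (n : ℝ) ^ 2) - (Λ n : ℝ) / Real.sqrt n * (C * rexp 1 * t / (n : ℝ) ^ 2) := by
    ring
  have e3 : 2 * C * rexp 1 * t / (n : ℝ) ^ 2 = 2 * (C * rexp 1 * t / (n : ℝ) ^ 2) := by ring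
  rw [e3]
  linarith

/-- `2πe^{2s} − 13/2 > 0` for `s ≥ 1/2` (indeed `≥ 2πe − 13/2 > 9`). -/
theorem toothExponent_pos {s : ℝ} (hs : 1 / 2 ≤ s) : 0 < 2 * π * rexp (2 * s) - 13 / 2 := by
  have he : rexp 1 ≤ rexp (2 * s) := Real.exp_le_exp.2 (by linarith)
  have h1 := Real.exp_one_gt_d9
  nlinarith [Real.pi_gt_three]

/-- `e² > 7.38`. -/
theorem exp_two_gt : (7.38 : ℝ) < rexp 2 := by
  have h1 := Real.exp_one_gt_d9
  have : rexp 2 = rexp 1 * rexp 1 := by rw [← Real.exp_add]; norm_num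
  rw [this]
  nlinarith

/-- **Bulk/edge regime, termwise.** For `a ≥ 1`, `1/2 ≤ t < a` and `log n > a + t`: the ratio bound
used twice (`t → a → log n − t`) and `c_n ≤ 4e^{−a/4}` give
`term_n ≥ −16e^{−a/4}|Φ′(t)|·e^{−K(a)(log n − (a+t))}`, `K(a) = 2πe^{2a} − 13/2`. -/
theorem primeLayer_term_bulk {a t : ℝ}
    (hR : ∀ s₁ s₂ : ℝ, 1 / 2 ≤ s₁ → s₁ ≤ s₂ →
      |weilThetaPhiDeriv s₂| ≤
        2 * rexp (-(2 * π * rexp (2 * s₁) - 13 / 2) * (s₂ - s₁)) * |weilThetaPhiDeriv s₁|)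
    (ht : 1 / 2 ≤ t) (hta : t < a) {n : ℕ} (hn : a + t < Real.log n) :
    -(16 * rexp (-(a / 4)) * |weilThetaPhiDeriv t| *
        rexp (-(2 * π * rexp (2 * a) - 13 / 2) * (Real.log n - (a + t)))) ≤
      (Λ n : ℝ) / Real.sqrt n *
        (oddThetaTail a (t - Real.log n) + oddThetaTail a (t + Real.log n)) := by
  rw [primeLayer_term_eq (by linarith) hn]
  have hnpos : (0 : ℝ) < n := natCast_pos_of_log_pos (by linarith)
  set K : ℝ := 2 * π * rexp (2 * a) - 13 / 2 with hK
  -- the two ratio steps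
  have h1 : |weilThetaPhiDeriv (Real.log n - t)| ≤ 2 * rexp (-K * (Real.log n - t - a)) * |weilThetaPhiDeriv a| :=
    hR a (Real.log n - t) (by linarith) (by linarith)
  have h2 : |weilThetaPhiDeriv a| ≤ 2 * |weilThetaPhiDeriv t| := by
    have h3 := hR t a ht hta.le
    have hexp : rexp (-(2 * π * rexp (2 * t) - 13 / 2) * (a - t)) ≤ 1 := by
      apply Real.exp_le_one_iff.2
      have := toothExponent_pos ht
      nlinarith
    calc |weilThetaPhiDeriv a| ≤ 2 * rexp (-(2 * π * rexp (2 * t) - 13 / 2) * (a - t)) * |weilThetaPhiDeriv t| := h3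
      _ ≤ 2 * 1 * |weilThetaPhiDeriv t| :=
          mul_le_mul_of_nonneg_right (mul_le_mul_of_nonneg_left hexp (by norm_num)) (abs_nonneg _)
      _ = 2 * |weilThetaPhiDeriv t| := by ring
  have hE : 0 ≤ rexp (-K * (Real.log n - t - a)) := (Real.exp_pos _).le
  have h4 : |weilThetaPhiDeriv (Real.log n - t)| ≤
      4 * rexp (-K * (Real.log n - (a + t))) * |weilThetaPhiDeriv t| := by
    have e1 : Real.log n - t - a = Real.log n - (a + t) := by ring
    rw [e1] at h1 hE
    nlinarith [abs_nonneg (weilThetaPhiDeriv t)]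
  -- the weight `c_n ≤ 4 e^{−a/4}`
  have hc : (Λ n : ℝ) / Real.sqrt n ≤ 4 * rexp (-(a / 4)) := by
    have h5 := vonMangoldt_div_sqrt_le n (by exact_mod_cast hnpos)
    refine h5.trans ?_
    have hea : rexp (a / 4) ≤ Real.sqrt (Real.sqrt n) := by
      rw [Real.le_sqrt' (Real.exp_pos _), ← Real.exp_nat_mul, Real.le_sqrt' (Real.exp_pos _),
        ← Real.exp_nat_mul]
      have e2 : ((2 : ℕ) : ℝ) * (((2 : ℕ) : ℝ) * (a / 4)) = a := by push_cast; ring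
      rw [e2]
      have : rexp a < n := by
        rw [← Real.exp_log hnpos]; exact Real.exp_lt_exp.2 (by linarith)
      exact this.le
    rw [div_le_iff₀ (lt_of_lt_of_le (Real.exp_pos _) hea), Real.exp_neg]
    have hpos : 0 < rexp (a / 4) := Real.exp_pos _
    calc (4 : ℝ) = 4 * (rexp (a / 4))⁻¹ * rexp (a / 4) := by field_simp
      _ ≤ 4 * (rexp (a / 4))⁻¹ * Real.sqrt (Real.sqrt n) :=
          mul_le_mul_of_nonneg_left hea (by positivity)
  have hc0 := vonMangoldt_div_sqrt_nonneg n
  -- the right-tail atom has the good sign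
  have hpos : 0 ≤ -weilThetaPhiDeriv (Real.log n + t) := by
    have : 0 < Real.log n + t := by linarith
    linarith [weilThetaPhiDeriv_neg_of_pos this]
  have hneg : weilThetaPhiDeriv (Real.log n - t) = -|weilThetaPhiDeriv (Real.log n - t)| := by
    have : 0 < Real.log n - t := by linarith
    rw [abs_of_neg (weilThetaPhiDeriv_neg_of_pos this)]; ring
  rw [hneg]
  have hA : 0 ≤ |weilThetaPhiDeriv (Real.log n - t)| := abs_nonneg _
  have hT : 0 ≤ 4 * rexp (-K * (Real.log n - (a + t))) * |weilThetaPhiDeriv t| := by positivity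
  nlinarith [mul_le_mul hc h4 hA (by positivity)]

/-! ## Lower bounds for the layer -/

/-- From a termwise lower bound `−w_n ≤ f_n` with a summable non-negative `w` to
`−Σ w ≤ Σ' f` (if `f` is not summable its `tsum` is `0`). -/
theorem neg_tsum_le_tsum_of_termwise {f w : ℕ → ℝ} (hw : Summable w) (hw0 : ∀ n, 0 ≤ w n)
    (hle : ∀ n, -w n ≤ f n) : -(∑' n, w n) ≤ ∑' n, f n := by
  by_cases hf : Summable f
  · rw [← tsum_neg]
    exact hw.neg.tsum_le_tsum hle hf
  · rw [tsum_eq_zero_of_not_summable hf]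
    exact neg_nonpos.2 (tsum_nonneg hw0)

/-- **Origin regime.** For `a ≥ 1` and `0 < t ≤ 1/2`:
`P_a(t) ≥ −2Ce·t·τ(⌊e^a⌋₊ + 1)`, `τ(N) = Σ_k 1/(k+N)²`. -/
theorem primeLayer_origin {C a t : ℝ}
    (hC : ∀ u : ℝ, 0 ≤ u → |deBruijnPhiDeriv₂ u| ≤ C * rexp (-4 * u))
    (ha : 1 ≤ a) (ht : 0 < t) (ht2 : t ≤ 1 / 2) :
    -(2 * C * rexp 1 * t * ∑' k : ℕ, 1 / ((k + (⌊rexp a⌋₊ + 1) : ℕ) : ℝ) ^ 2) ≤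
      oddThetaPrimeLayer a t := by
  have hC0 : 0 ≤ C := by
    have h := hC 0 le_rfl
    simp only [mul_zero, Real.exp_zero, mul_one] at h
    exact (abs_nonneg _).trans h
  set N : ℕ := ⌊rexp a⌋₊ + 1 with hN
  set w : ℕ → ℝ := fun n => if N ≤ n then 2 * C * rexp 1 * t / (n : ℝ) ^ 2 else 0 with hw
  have hw0 : ∀ n, 0 ≤ w n := fun n => by simp only [hw]; split_ifs <;> positivity
  have hwsum : Summable w := by
    refine Summable.of_nonneg_of_le hw0 (fun n => ?_) ((hasSum_zeta_two.summable).mul_left (2 * C * rexp 1 * t))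
    simp only [hw]
    split_ifs
    · exact le_of_eq (by ring)
    · positivity
  have hle : ∀ n : ℕ, -w n ≤ (Λ n : ℝ) / Real.sqrt n *
      (oddThetaTail a (t - Real.log n) + oddThetaTail a (t + Real.log n)) := fun n => by
    by_cases hn : a + t < Real.log n
    · have hnpos : (0 : ℝ) < n := natCast_pos_of_log_pos (by linarith)
      have hNn : N ≤ n := by
        rw [hN, Nat.succ_le_iff, Nat.floor_lt (Real.exp_pos a).le, ← Real.exp_log hnpos]
        exact Real.exp_lt_exp.2 (by linarith)
      simp only [hw, if_pos hNn]
      exact primeLayer_term_origin hC ha ht ht2 hn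
    · exact (neg_nonpos.2 (hw0 n)).trans (primeLayer_term_nonneg ht (by linarith) (not_lt.1 hn))
  have h := neg_tsum_le_tsum_of_termwise hwsum hw0 hle
  rw [show (∑' n, w n) = 2 * C * rexp 1 * t * ∑' k : ℕ, 1 / ((k + N : ℕ) : ℝ) ^ 2 from
    tsum_ite_le_eq_tail N (2 * C * rexp 1 * t)] at h
  exact h

/-- **Bulk/edge regime.** For `a ≥ 1` and `1/2 ≤ t < a`: `P_a(t) ≥ −48e^{−a/4}|Φ′(t)|`. -/
theorem primeLayer_bulk {a t : ℝ}
    (hR : ∀ s₁ s₂ : ℝ, 1 / 2 ≤ s₁ → s₁ ≤ s₂ →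
      |weilThetaPhiDeriv s₂| ≤
        2 * rexp (-(2 * π * rexp (2 * s₁) - 13 / 2) * (s₂ - s₁)) * |weilThetaPhiDeriv s₁|)
    (ha : 1 ≤ a) (ht : 1 / 2 ≤ t) (hta : t < a) :
    -(48 * rexp (-(a / 4)) * |weilThetaPhiDeriv t|) ≤ oddThetaPrimeLayer a t := by
  set K : ℝ := 2 * π * rexp (2 * a) - 13 / 2 with hK
  set L : ℝ := a + t with hL
  -- the tooth sum applies: `K ≥ 2`, `K ≥ 5 e^{a+t}`
  have he2 : rexp 2 ≤ rexp (2 * a) := Real.exp_le_exp.2 (by linarith)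
  have hK2 : 2 ≤ K := by
    have := exp_two_gt
    nlinarith [Real.pi_gt_three]
  have hKL : 5 * rexp L ≤ K := by
    have h1 : rexp L ≤ rexp (2 * a) := Real.exp_le_exp.2 (by simp only [hL]; linarith)
    have := exp_two_gt
    nlinarith [Real.pi_gt_three, Real.exp_pos L]
  obtain ⟨hfsum, hf3⟩ := tooth_sum_le (by simp only [hL]; linarith) hK2 hKL
  set A : ℝ := 16 * rexp (-(a / 4)) * |weilThetaPhiDeriv t| with hA
  have hA0 : 0 ≤ A := by positivity
  set w : ℕ → ℝ := fun n => A * (if rexp L < (n : ℝ) then rexp (-K * (Real.log n - L)) else 0) with hw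
  have hw0 : ∀ n, 0 ≤ w n := fun n => by
    simp only [hw]; split_ifs <;> positivity
  have hwsum : Summable w := hfsum.mul_left A
  have hle : ∀ n : ℕ, -w n ≤ (Λ n : ℝ) / Real.sqrt n *
      (oddThetaTail a (t - Real.log n) + oddThetaTail a (t + Real.log n)) := fun n => by
    by_cases hn : a + t < Real.log n
    · have hnpos : (0 : ℝ) < n := natCast_pos_of_log_pos (by linarith)
      have hcond : rexp L < (n : ℝ) := by
        rw [← Real.exp_log hnpos]; exact Real.exp_lt_exp.2 (by simp only [hL]; linarith)
      simp only [hw, if_pos hcond]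
      have := primeLayer_term_bulk hR ht hta hn
      simp only [hA, hL] at this ⊢
      linarith
    · exact (neg_nonpos.2 (hw0 n)).trans (primeLayer_term_nonneg (by linarith) hta (not_lt.1 hn))
  have h := neg_tsum_le_tsum_of_termwise hwsum hw0 hle
  have hwle : ∑' n, w n ≤ A * 3 := by
    simp only [hw]
    rw [tsum_mul_left]
    exact mul_le_mul_of_nonneg_left hf3 hA0
  have : oddThetaPrimeLayer a t = ∑' n : ℕ, (Λ n : ℝ) / Real.sqrt n *
      (oddThetaTail a (t - Real.log n) + oddThetaTail a (t + Real.log n)) := rfl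
  rw [this]
  simp only [hA] at hwle
  linarith

/-! ## The stub -/

/-- **The prime-layer floor** (stub `stub_primeLayerFloor` of the skeleton): given the ratio bound
for `|Φ′|`, the decay of `Φ_RT″` and the linear lower bound for `−Φ′` on `[0,1]`, there are `a₀`
(`= 1`) and `e → 0` with `P_a(t) ≥ e(a)·Φ′(t)` for all `a ≥ a₀`, `t ∈ (0,a)`; explicitly
`e(a) = (2Ce/c)·τ(⌊e^a⌋₊+1) + 48e^{−a/4}`. -/
theorem stub_primeLayerFloor :
    (∀ s₁ s₂ : ℝ, 1 / 2 ≤ s₁ → s₁ ≤ s₂ →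
        |weilThetaPhiDeriv s₂| ≤
          2 * rexp (-(2 * π * rexp (2 * s₁) - 13 / 2) * (s₂ - s₁)) * |weilThetaPhiDeriv s₁|) →
    (∃ C : ℝ, ∀ u : ℝ, 0 ≤ u → |deBruijnPhiDeriv₂ u| ≤ C * rexp (-4 * u)) →
    (∃ c : ℝ, 0 < c ∧ ∀ t ∈ Icc (0 : ℝ) 1, c * t ≤ -weilThetaPhiDeriv t) →
    ∃ a₀ : ℝ, ∃ e : ℝ → ℝ, Tendsto e atTop (𝓝 0) ∧ ∀ a : ℝ, a₀ ≤ a → ∀ t ∈ Ioo 0 a,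
      e a * weilThetaPhiDeriv t ≤ oddThetaPrimeLayer a t := by
  rintro hR ⟨C, hC⟩ ⟨c, hc, hfloor⟩
  have hC0 : 0 ≤ C := by
    have h := hC 0 le_rfl
    simp only [mul_zero, Real.exp_zero, mul_one] at h
    exact (abs_nonneg _).trans h
  set τ : ℕ → ℝ := fun N => ∑' k : ℕ, 1 / ((k + N : ℕ) : ℝ) ^ 2 with hτ
  set e : ℝ → ℝ := fun a => 2 * C * rexp 1 / c * τ (⌊rexp a⌋₊ + 1) + 48 * rexp (-(a / 4)) with he
  refine ⟨1, e, ?_, fun a ha t ht => ?_⟩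
  · -- `e → 0`
    have hN : Tendsto (fun a : ℝ => ⌊rexp a⌋₊ + 1) atTop atTop :=
      (tendsto_add_atTop_nat 1).comp (tendsto_nat_floor_atTop.comp Real.tendsto_exp_atTop)
    have h1 : Tendsto (fun a : ℝ => τ (⌊rexp a⌋₊ + 1)) atTop (𝓝 0) := tendsto_tail_zeta_two.comp hN
    have h2 : Tendsto (fun a : ℝ => rexp (-(a / 4))) atTop (𝓝 0) := by
      have h3 : Tendsto (fun a : ℝ => -(a / 4)) atTop atBot := by
        have := (tendsto_neg_atTop_atBot (G := ℝ)).atBot_div_const (r := 4) (by norm_num)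
        refine this.congr fun a => ?_
        ring
      exact Real.tendsto_exp_atBot.comp h3
    have h4 := (h1.const_mul (2 * C * rexp 1 / c)).add (h2.const_mul 48)
    simpa [he] using h4
  · have hτ0 : 0 ≤ τ (⌊rexp a⌋₊ + 1) := tail_zeta_two_nonneg _
    have he1 : 2 * C * rexp 1 / c * τ (⌊rexp a⌋₊ + 1) ≤ e a := by
      simp only [he]; linarith [Real.exp_pos (-(a / 4))]
    have he2 : 48 * rexp (-(a / 4)) ≤ e a := by
      simp only [he]
      have : 0 ≤ 2 * C * rexp 1 / c * τ (⌊rexp a⌋₊ + 1) := by positivity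
      linarith
    have ht0 : 0 < t := ht.1
    have hneg : weilThetaPhiDeriv t ≤ 0 := (weilThetaPhiDeriv_neg_of_pos ht0).le
    rcases le_or_gt t (1 / 2) with ht2 | ht2
    · -- origin regime
      have h1 := primeLayer_origin hC ha ht.1 ht2
      refine le_trans ?_ h1
      have hct : c * t ≤ -weilThetaPhiDeriv t := hfloor t ⟨ht.1.le, by linarith⟩
      have hprod : 2 * C * rexp 1 / c * τ (⌊rexp a⌋₊ + 1) * (c * t) ≤ e a * (-weilThetaPhiDeriv t) :=
        mul_le_mul he1 hct (by positivity) ((by positivity : (0:ℝ) ≤ _).trans he1)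
      have e1 : 2 * C * rexp 1 / c * τ (⌊rexp a⌋₊ + 1) * (c * t) =
          2 * C * rexp 1 * t * τ (⌊rexp a⌋₊ + 1) := by
        field_simp
      rw [e1] at hprod
      linarith
    · -- bulk/edge regime
      have h1 := primeLayer_bulk hR ha ht2.le ht.2
      refine le_trans ?_ h1
      rw [abs_of_nonpos hneg]
      have := mul_le_mul_of_nonpos_right he2 hneg
      linarith

end Summit.RiemannHypothesis.RiemannHypothesis.Theorems.OddBartaFloor

end
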